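import Literature.Analysis.FluidPDE.OseenSlabQualitative
import Literature.Analysis.FluidPDE.OseenDuhamelRadialDecayUniform
import Literature.Analysis.FluidPDE.TypeIAncientMild
import Literature.Analysis.FluidPDE.SteadyLiouvilleCriteriaProofs
import HarnessLib

/-!
# `stub_rdssSlabFlow` — the one-period perturbation flow around a Type-I rotated-DSS profile
  (crux stmt-NavierStokesRegularity-11289 `RdssProfileTruncation`, line `Sketch`)

Summits-side stub file (everything proved).  The sup-norm perturbation theory of the Oseen
integral equation on the slab `[−1, −c⁻²/2]` (`Literature.Analysis.FluidPDE.OseenSlab*`) read off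
at the physical level of the registered stub: the flow `Φ g = slabPhys (sol ĝ)`, the compact part
`Klin h = A ĥ (−c⁻²) − e^{(1−c⁻²)Δ} h = −L[u](A ĥ)(−c⁻²)` of the derivative of the final slice,
its linearity, class preservation, uniformly small tails and uniform modulus of continuity on the
unit ball, and the strict differentiability estimate at `0`.

## References

* G. Koch, N. Nadirashvili, G. Seregin, V. Šverák, Acta Math. 203 (2009) = arXiv:0709.3599, §4.
  [KochNadirashviliSereginSverak2009]
* D. Henry, *Geometric Theory of Semilinear Parabolic Equations*, LNM 840 (1981), Thm. 3.4.4.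
  [Henry1981]
-/

noncomputable section


namespace Summit.NavierStokesRegularity.NavierStokesRegularity.Theorems

open Literature.Analysis.FluidPDE MeasureTheory Set Filter Topology Function
open scoped BoundedContinuousFunction

set_option linter.dupNamespace false

/-- Physical space `ℝ³`. -/
local notation "ℝ³" => EuclideanSpace ℝ (Fin 3)

set_option maxHeartbeats 800000 in
/-- **stub_rdssSlabFlow** — the one-period flow of sup-small perturbations of a Type-I rotated-DSS
Oseen-gauge profile: solution operator `Φ` on the physical slab `[−1, −c⁻²]` (built on the longer
slab `[−1, −c⁻²/2]` so that the evaluation time is interior), `Φ 0 = 0`, the Oseen equation for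
`u + Φ g` between all pairs of slab times, continuity, spatial decay and weak divergence-freeness of
the slices, sup bounds, Lipschitz dependence, and the strict derivative at `0` of the final slice,
`heatFlow (·) (1 − c⁻²) + Klin` with `Klin h = −L_{−1}[u]((1+L)⁻¹ e^{(·+1)Δ} h)(−c⁻²)` linear, class
preserving, with uniformly small tails and a uniform modulus of continuity on the unit ball
(`Literature.Analysis.FluidPDE.exists_slabSolutionMap` and the slab toolbox `OseenSlab*.lean`).
[cite: KochNadirashviliSereginSverak2009, §4 (4.3)–(4.4); Henry1981, Thm 3.4.4] -/
theorem stub_rdssSlabFlow :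
    ∀ (C C₀ c : ℝ) (R : ℝ³ ≃ₗᵢ[ℝ] ℝ³) (u : ℝ → ℝ³ → ℝ³),
      IsTypeIAncientMild C u → IsRotatedDSS c R u → 1 < c → HasTypeIDecay C₀ u →
      ∃ δ₀ : ℝ, 0 < δ₀ ∧ ∃ Λ : ℝ, 0 ≤ Λ ∧
        ∃ (Φ : (ℝ³ → ℝ³) → ℝ → ℝ³ → ℝ³) (Klin : (ℝ³ → ℝ³) → ℝ³ → ℝ³),
        (∀ t x, Φ 0 t x = 0) ∧
        (∀ g : ℝ³ → ℝ³, Continuous g → Tendsto g (cocompact ℝ³) (𝓝 0) → IsWeaklyDivFree g →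
          ∀ B : ℝ, (∀ x, ‖g x‖ ≤ B) → B < δ₀ →
            Φ g (-1) = g ∧
            ContinuousOn (uncurry (Φ g)) (Icc (-1) (-(c ^ 2)⁻¹) ×ˢ univ) ∧
            (∀ t ∈ Icc (-1 : ℝ) (-(c ^ 2)⁻¹), Tendsto (Φ g t) (cocompact ℝ³) (𝓝 0) ∧
              IsWeaklyDivFree (Φ g t) ∧ ∀ x, ‖Φ g t x‖ ≤ Λ * B) ∧
            (∀ s t : ℝ, -1 ≤ s → s < t → t ≤ -(c ^ 2)⁻¹ → ∀ x,
              (u + Φ g) t x = heatFlow ((u + Φ g) s) (t - s) x -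
                oseenDuhamel 1 s (u + Φ g) (u + Φ g) t x)) ∧
        (∀ g₁ g₂ : ℝ³ → ℝ³, Continuous g₁ → Tendsto g₁ (cocompact ℝ³) (𝓝 0) → IsWeaklyDivFree g₁ →
          Continuous g₂ → Tendsto g₂ (cocompact ℝ³) (𝓝 0) → IsWeaklyDivFree g₂ →
          ∀ B Bd : ℝ, (∀ x, ‖g₁ x‖ ≤ B) → (∀ x, ‖g₂ x‖ ≤ B) → B < δ₀ → (∀ x, ‖g₁ x - g₂ x‖ ≤ Bd) →
            ∀ t ∈ Icc (-1 : ℝ) (-(c ^ 2)⁻¹), ∀ x, ‖Φ g₁ t x - Φ g₂ t x‖ ≤ Λ * Bd) ∧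
        (∀ h₁ h₂ : ℝ³ → ℝ³, Continuous h₁ → Tendsto h₁ (cocompact ℝ³) (𝓝 0) → IsWeaklyDivFree h₁ →
          Continuous h₂ → Tendsto h₂ (cocompact ℝ³) (𝓝 0) → IsWeaklyDivFree h₂ → ∀ r : ℝ,
            Klin (h₁ + h₂) = Klin h₁ + Klin h₂ ∧ Klin (r • h₁) = r • Klin h₁) ∧
        (∀ h : ℝ³ → ℝ³, Continuous h → Tendsto h (cocompact ℝ³) (𝓝 0) → IsWeaklyDivFree h →
          ∀ B : ℝ, (∀ x, ‖h x‖ ≤ B) →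
            Continuous (Klin h) ∧ Tendsto (Klin h) (cocompact ℝ³) (𝓝 0) ∧ IsWeaklyDivFree (Klin h) ∧
              ∀ x, ‖Klin h x‖ ≤ Λ * B) ∧
        (∀ ε : ℝ, 0 < ε → ∃ A : ℝ, ∀ h : ℝ³ → ℝ³, Continuous h → Tendsto h (cocompact ℝ³) (𝓝 0) →
          IsWeaklyDivFree h → (∀ x, ‖h x‖ ≤ 1) → ∀ x, A ≤ ‖x‖ → ‖Klin h x‖ ≤ ε) ∧
        (∀ ε : ℝ, 0 < ε → ∃ δ : ℝ, 0 < δ ∧ ∀ h : ℝ³ → ℝ³, Continuous h → Tendsto h (cocompact ℝ³) (𝓝 0) →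
          IsWeaklyDivFree h → (∀ x, ‖h x‖ ≤ 1) → ∀ x y, dist x y < δ → ‖Klin h x - Klin h y‖ ≤ ε) ∧
        (∀ ε : ℝ, 0 < ε → ∃ δ : ℝ, 0 < δ ∧ ∀ g₁ g₂ : ℝ³ → ℝ³,
          Continuous g₁ → Tendsto g₁ (cocompact ℝ³) (𝓝 0) → IsWeaklyDivFree g₁ →
          Continuous g₂ → Tendsto g₂ (cocompact ℝ³) (𝓝 0) → IsWeaklyDivFree g₂ →
          ∀ B Bd : ℝ, (∀ x, ‖g₁ x‖ ≤ B) → (∀ x, ‖g₂ x‖ ≤ B) → B < δ → (∀ x, ‖g₁ x - g₂ x‖ ≤ Bd) →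
            ∀ x, ‖(Φ g₁ (-(c ^ 2)⁻¹) x - Φ g₂ (-(c ^ 2)⁻¹) x) -
              (heatFlow (g₁ - g₂) (1 - (c ^ 2)⁻¹) x + Klin (g₁ - g₂) x)‖ ≤ ε * Bd) := by
  intro C C₀ c R u hK _hrdss hc hdec
  -- the slab `[a, b] = [−1, −c⁻²/2]` and the evaluation time `b' = −c⁻²`
  have hc0 : 0 < c := zero_lt_one.trans hc
  have hc2 : 1 < c ^ 2 := by nlinarith
  have hic : 0 < (c ^ 2)⁻¹ := by positivity
  have hic1 : (c ^ 2)⁻¹ < 1 := inv_lt_one_of_one_lt₀ hc2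
  set a : ℝ := -1 with ha
  set b : ℝ := -(c ^ 2)⁻¹ / 2 with hb
  set b' : ℝ := -(c ^ 2)⁻¹ with hb'
  have hab : a ≤ b := by rw [ha, hb]; linarith
  have hb0 : b < 0 := by rw [hb]; linarith
  have hb'mem : b' ∈ Icc a b := ⟨by rw [ha, hb']; linarith, by rw [hb, hb']; linarith⟩
  have hab' : a < b' := by rw [ha, hb']; linarith
  have hslab0 : ∀ t ∈ Icc a b, t < 0 := fun t ht => ht.2.trans_lt hb0
  -- the background slab field `U`
  have hCn : 0 ≤ C := hK.nonneg
  set M : ℝ := C / Real.sqrt ((c ^ 2)⁻¹ / 2) with hM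
  have hM0 : 0 ≤ M := by positivity
  have hucont : ContinuousOn (uncurry u) (Icc a b ×ˢ univ) :=
    hK.continuousOn_uncurry.mono (prod_mono (fun t ht => hslab0 t ht) subset_rfl)
  have hubd : ∀ t ∈ Icc a b, ∀ x, ‖u t x‖ ≤ M := by
    intro t ht x
    refine (hK.norm_le (hslab0 t ht) x).trans ?_
    rw [hM]
    have h1 : (c ^ 2)⁻¹ / 2 ≤ -t := by rw [hb] at ht; linarith [ht.2]
    exact div_le_div_of_nonneg_left hCn (Real.sqrt_pos.2 (by positivity))
      (Real.sqrt_le_sqrt h1)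
  set U : (Icc a b) × ℝ³ →ᵇ ℝ³ := slabMk u hucont M hubd with hU
  have hUphys : ∀ t ∈ Icc a b, slabPhys hab U t = u t := fun t ht => by
    funext x; rw [slabPhys_slabMk hab u hucont M hubd ht]
  have hUapp : ∀ t (ht : t ∈ Icc a b) x, U (⟨t, ht⟩, x) = u t x := fun t ht x => rfl
  -- `U` solves its own Oseen equation from `a = −1`
  set U₀ : ℝ³ →ᵇ ℝ³ := slabSlice U ⟨a, left_mem_Icc.2 hab⟩ with hU₀
  have hU₀ : (⇑U₀ : ℝ³ → ℝ³) = u a := by funext x; rw [hU₀, slabSlice_apply, hUapp]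
  have hcongrU : ∀ {s t : ℝ}, a ≤ s → t ∈ Icc a b → ∀ x,
      oseenDuhamel 1 s u u t x = oseenDuhamel 1 s (slabPhys hab U) (slabPhys hab U) t x := by
    intro s t hs ht x
    refine LongLivedOseenSolution.oseenDuhamel_congr (fun τ hτ => ?_) (fun τ hτ => ?_) x <;>
      exact (hUphys τ ⟨hs.trans hτ.1.le, hτ.2.le.trans ht.2⟩).symm
  have hUeq : ∀ t (ht : t ∈ Icc a b) (x : ℝ³), U (⟨t, ht⟩, x) =
      heatFlow (⇑U₀) (t - a) x - oseenDuhamel 1 a (slabPhys hab U) (slabPhys hab U) t x := by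
    intro t ht x
    rw [hUapp, hU₀]
    rcases ht.1.eq_or_lt with h | hat
    · rw [← h, sub_self, heatFlow_zero, oseenDuhamel_eq_zero_of_le le_rfl, sub_zero]
    · rw [hK.mild_eq hat (hslab0 t ht) x, hcongrU le_rfl ht]
  -- the background vanishes at spatial infinity uniformly (Type-I spatial decay)
  have hUcz : U ∈ slabCZero (E := ℝ³) a b := by
    intro ε hε
    refine ⟨|C₀| / ε + 1, fun p hp => ?_⟩
    obtain ⟨⟨t, ht⟩, y⟩ := p
    have hy0 : 0 < ‖y‖ := by
      have : 0 ≤ |C₀| / ε := by positivity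
      exact lt_of_lt_of_le (by linarith) hp
    rw [hUapp]
    have h1 := hdec t (hslab0 t ht) y
    have hden : ‖y‖ ≤ ‖y‖ + Real.sqrt (-t) := le_add_of_nonneg_right (Real.sqrt_nonneg _)
    calc ‖u t y‖ ≤ C₀ / (‖y‖ + Real.sqrt (-t)) := h1
      _ ≤ |C₀| / (‖y‖ + Real.sqrt (-t)) := by gcongr; exact le_abs_self _
      _ ≤ |C₀| / ‖y‖ := div_le_div_of_nonneg_left (abs_nonneg _) hy0 hden
      _ ≤ ε := by
          rw [div_le_iff₀ hy0]
          have : |C₀| / ε + 1 ≤ ‖y‖ := hp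
          have h2 : |C₀| / ε * ε = |C₀| := by field_simp
          nlinarith [abs_nonneg C₀]
  -- the solution operator on the slab
  obtain ⟨A, hA, r, hr, ρ, hρ, sol, hsol0, hsol, _huniq, hLip, hbd, hderiv, hinv⟩ :=
    exists_slabSolutionMap hab U
  -- data as bounded continuous functions
  have adm_bdd : ∀ g : ℝ³ → ℝ³, Continuous g → Tendsto g (cocompact ℝ³) (𝓝 0) →
      ∃ B : ℝ, ∀ x, ‖g x‖ ≤ B := fun g hg h0 => exists_forall_norm_le_of_tendsto_cocompact hg h0
  -- the flow and the compact part of its derivative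
  let Φ : (ℝ³ → ℝ³) → ℝ → ℝ³ → ℝ³ := fun g => slabPhys hab (sol (bcfOfBounded g))
  let Klin : (ℝ³ → ℝ³) → ℝ³ → ℝ³ := fun h x => A (bcfOfBounded h) (⟨b', hb'mem⟩, x) - heatFlow h (b' - a) x
  have hb'a : b' - a = 1 - (c ^ 2)⁻¹ := by rw [hb', ha]; ring
  -- `Klin h = −L(A ĥ)(b')` and its sup bound
  have hKlin_eq : ∀ h : ℝ³ → ℝ³, Continuous h → ∀ B, (∀ x, ‖h x‖ ≤ B) → ∀ x,
      Klin h x = -(slabLin hab U (A (bcfOfBounded h)) (⟨b', hb'mem⟩, x)) := by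
    intro h hh B hB x
    have h1 := congrArg (fun W : (Icc a b) × ℝ³ →ᵇ ℝ³ => W (⟨b', hb'mem⟩, x)) (hA (bcfOfBounded h))
    simp only [BoundedContinuousFunction.coe_add, Pi.add_apply, slabHeat_apply] at h1
    simp only [Klin]
    rw [bcfOfBounded_coe hh hB] at h1
    rw [← h1]; abel
  set Λ : ℝ := 2 * ‖A‖ + ‖slabLin hab U‖ * ‖A‖ with hΛ
  have hΛ0 : 0 ≤ Λ := by positivity
  refine ⟨r, hr, Λ, hΛ0, Φ, Klin, ?_, ?_, ?_, ?_, ?_, ?_, ?_, ?_⟩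
  · -- `Φ 0 = 0`
    intro t x
    simp only [Φ, bcfOfBounded_zero, hsol0]
    by_cases ht : t ∈ Icc a b
    · rw [slabPhys_of_mem hab _ ht]; rfl
    · rw [slabPhys_of_not_mem hab _ ht]
  · -- solution properties for admissible small data
    intro g hg hg0 hgdiv B hB hBr
    have hB0 : 0 ≤ B := (norm_nonneg _).trans (hB 0)
    have hgn : ‖bcfOfBounded g‖ < r := (norm_bcfOfBounded_le hg hB).trans_lt hBr
    obtain ⟨hwρ, heq⟩ := hsol (bcfOfBounded g) hgn
    set w := sol (bcfOfBounded g) with hw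
    have hgcoe := bcfOfBounded_coe hg hB
    -- `w` vanishes at infinity uniformly: invariance of `slabCZero`
    have hwcz : w ∈ slabCZero (E := ℝ³) a b :=
      hinv (slabCZero a b) (isClosed_slabCZero (E := ℝ³)) (fun V => slabLin_mem_slabCZero hab hUcz V)
        (bcfOfBounded g) hgn (slabHeat_mem_slabCZero (by rw [hgcoe]; exact hg0))
        (fun w' hw' _ => slabBilin_mem_slabCZero_left hab hw' w')
    refine ⟨?_, ?_, ?_, ?_⟩
    · -- `Φ g (−1) = g`
      funext x
      have hamem : a ∈ Icc a b := left_mem_Icc.2 hab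
      show slabPhys hab w a x = g x
      rw [slab_perturbation_pointwise hab heq hamem x, sub_self, heatFlow_zero, hgcoe, linOseen,
        oseenDuhamel_eq_zero_of_le le_rfl, oseenDuhamel_eq_zero_of_le le_rfl,
        oseenDuhamel_eq_zero_of_le le_rfl]
      simp
    · exact (continuousOn_uncurry_slabPhys hab w).mono (prod_mono (Icc_subset_Icc_right hb'mem.2)
        subset_rfl)
    · intro t ht
      have ht' : t ∈ Icc a b := ⟨ht.1, ht.2.trans hb'mem.2⟩
      refine ⟨?_, slab_solution_isWeaklyDivFree hab heq (by rw [hgcoe]; exact hgdiv) t, fun x => ?_⟩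
      · refine tendsto_cocompact_nhds_zero_iff_norm.2 fun ε hε => ?_
        obtain ⟨R₀, hR₀⟩ := hwcz ε hε
        exact ⟨R₀, fun x hx => by
          show ‖slabPhys hab w t x‖ ≤ ε
          rw [slabPhys_of_mem hab w ht']; exact hR₀ (⟨t, ht'⟩, x) hx⟩
      · show ‖slabPhys hab w t x‖ ≤ Λ * B
        calc ‖slabPhys hab w t x‖ ≤ ‖w‖ := norm_slabPhys_le hab w t x
          _ ≤ 2 * ‖A‖ * ‖bcfOfBounded g‖ := hbd _ hgn
          _ ≤ 2 * ‖A‖ * B := by gcongr; exact norm_bcfOfBounded_le hg hB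
          _ ≤ Λ * B := by
              rw [hΛ]
              nlinarith [mul_nonneg (mul_nonneg (norm_nonneg (slabLin hab U)) (norm_nonneg A)) hB0]
    · -- the Oseen equation for `u + Φ g` between all pairs of slab times
      intro s t hs hst htb' x
      have hsmem : s ∈ Icc a b := ⟨hs, (hst.le.trans htb').trans hb'mem.2⟩
      have htmem : t ∈ Icc a b := ⟨hs.trans hst.le, htb'.trans hb'mem.2⟩
      have hV : ∀ τ (hτ : τ ∈ Icc a b) (y : ℝ³), (U + w) (⟨τ, hτ⟩, y) =
          heatFlow (⇑(U₀ + bcfOfBounded g)) (τ - a) y -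
            oseenDuhamel 1 a (slabPhys hab (U + w)) (slabPhys hab (U + w)) τ y := by
        intro τ hτ y
        have h := slab_full_equation hab (U₀ := U₀) (g := bcfOfBounded g) hUeq heq hτ y
        rwa [slabPhys_of_mem hab _ hτ] at h
      have hrest := slab_restart hab hV hsmem hst htmem x
      -- identify `u + Φ g` with the physical field of `U + w` on the slab
      have hid : ∀ τ ∈ Icc a b, (u + Φ g) τ = slabPhys hab (U + w) τ := by
        intro τ hτ
        funext y
        simp only [Φ, Pi.add_apply, slabPhys_add, ← hw, hUphys τ hτ]
      rw [hid t htmem, hid s hsmem, slabPhys_of_mem hab _ htmem, hrest]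
      congr 1
      exact (LongLivedOseenSolution.oseenDuhamel_congr (fun τ hτ => hid τ ⟨hs.trans hτ.1.le,
        hτ.2.le.trans htmem.2⟩) (fun τ hτ => hid τ ⟨hs.trans hτ.1.le, hτ.2.le.trans htmem.2⟩) x).symm
  · -- Lipschitz dependence
    intro g₁ g₂ hg₁ _ _ hg₂ _ _ B Bd hB₁ hB₂ hBr hBd t ht x
    have hBd0 : 0 ≤ Bd := (norm_nonneg _).trans (hBd 0)
    have h1 : ‖bcfOfBounded g₁‖ < r := (norm_bcfOfBounded_le hg₁ hB₁).trans_lt hBr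
    have h2 : ‖bcfOfBounded g₂‖ < r := (norm_bcfOfBounded_le hg₂ hB₂).trans_lt hBr
    have ht' : t ∈ Icc a b := ⟨ht.1, ht.2.trans hb'mem.2⟩
    have hd : ‖bcfOfBounded g₁ - bcfOfBounded g₂‖ ≤ Bd := by
      rw [← bcfOfBounded_sub hg₁ ⟨B, hB₁⟩ hg₂ ⟨B, hB₂⟩]
      exact norm_bcfOfBounded_le (hg₁.sub hg₂) hBd
    show ‖slabPhys hab (sol (bcfOfBounded g₁)) t x - slabPhys hab (sol (bcfOfBounded g₂)) t x‖ ≤ Λ * Bd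
    rw [slabPhys_of_mem hab _ ht', slabPhys_of_mem hab _ ht', ← BoundedContinuousFunction.sub_apply]
    calc ‖(sol (bcfOfBounded g₁) - sol (bcfOfBounded g₂)) (⟨t, ht'⟩, x)‖ ≤ ‖sol (bcfOfBounded g₁) - sol (bcfOfBounded g₂)‖ :=
          BoundedContinuousFunction.norm_coe_le_norm _ _
      _ ≤ 2 * ‖A‖ * ‖bcfOfBounded g₁ - bcfOfBounded g₂‖ := hLip _ _ h1 h2
      _ ≤ 2 * ‖A‖ * Bd := by gcongr
      _ ≤ Λ * Bd := by
          rw [hΛ]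
          nlinarith [mul_nonneg (mul_nonneg (norm_nonneg (slabLin hab U)) (norm_nonneg A)) hBd0]
  · -- `Klin` is linear on admissible fields
    intro h₁ h₂ hh₁ hh₁0 _ hh₂ hh₂0 _ r'
    obtain ⟨B₁, hB₁⟩ := adm_bdd h₁ hh₁ hh₁0
    obtain ⟨B₂, hB₂⟩ := adm_bdd h₂ hh₂ hh₂0
    refine ⟨funext fun x => ?_, funext fun x => ?_⟩
    · simp only [Klin, Pi.add_apply, bcfOfBounded_add hh₁ ⟨B₁, hB₁⟩ hh₂ ⟨B₂, hB₂⟩, map_add,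
        BoundedContinuousFunction.coe_add]
      rw [show heatFlow (h₁ + h₂) (b' - a) x = heatFlow h₁ (b' - a) x + heatFlow h₂ (b' - a) x from
        heatFlow_add_of_bound hh₁ hh₂ hB₁ hB₂ _ _]
      abel
    · simp only [Klin, Pi.smul_apply, bcfOfBounded_smul r' hh₁ ⟨B₁, hB₁⟩, map_smul,
        BoundedContinuousFunction.coe_smul]
      rw [show heatFlow (r' • h₁) (b' - a) x = r' • heatFlow h₁ (b' - a) x from
        heatFlow_const_smul r' h₁ _ _, smul_sub]
  · -- `Klin` maps the class to itself, with a sup bound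
    intro h hh hh0 _ B hB
    have hB0 : 0 ≤ B := (norm_nonneg _).trans (hB 0)
    set W := A (bcfOfBounded h) with hW
    have hfun : Klin h = fun x => -(slabLin hab U W (⟨b', hb'mem⟩, x)) :=
      funext fun x => hKlin_eq h hh B hB x
    have hLslice : (fun x => slabLin hab U W (⟨b', hb'mem⟩, x)) =
        oseenDuhamel 1 a (slabPhys hab U) (slabPhys hab W) b' +
          oseenDuhamel 1 a (slabPhys hab W) (slabPhys hab U) b' := by
      funext x; rw [slabLin_apply, linOseen]; rfl
    refine ⟨?_, ?_, ?_, fun x => ?_⟩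
    · rw [hfun]; exact ((slabLin hab U W).continuous.comp (continuous_const.prodMk continuous_id)).neg
    · rw [hfun]
      refine tendsto_cocompact_nhds_zero_iff_norm.2 fun ε hε => ?_
      obtain ⟨R₀, hR₀⟩ := slabLin_mem_slabCZero hab hUcz W ε hε
      exact ⟨R₀, fun x hx => by rw [norm_neg]; exact hR₀ (⟨b', hb'mem⟩, x) hx⟩
    · rw [hfun, show (fun x => -(slabLin hab U W (⟨b', hb'mem⟩, x))) =
        (-1 : ℝ) • (fun x => slabLin hab U W (⟨b', hb'mem⟩, x)) by funext x; simp, hLslice]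
      exact ((isWeaklyDivFree_oseenDuhamel_slabPhys hab U W hb'mem.2).add_of_continuous
        (isWeaklyDivFree_oseenDuhamel_slabPhys hab W U hb'mem.2)
        (continuous_slabPhys_slice hab (slabBilin hab U W) b' |>.congr fun x => by
          rw [slabPhys_slabBilin hab U W hb'mem])
        (continuous_slabPhys_slice hab (slabBilin hab W U) b' |>.congr fun x => by
          rw [slabPhys_slabBilin hab W U hb'mem])).const_smul (-1)
    · rw [hKlin_eq h hh B hB x, norm_neg]
      calc ‖slabLin hab U W (⟨b', hb'mem⟩, x)‖ ≤ ‖slabLin hab U W‖ :=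
            BoundedContinuousFunction.norm_coe_le_norm _ _
        _ ≤ ‖slabLin hab U‖ * ‖W‖ := ContinuousLinearMap.le_opNorm _ _
        _ ≤ ‖slabLin hab U‖ * (‖A‖ * B) := by
            gcongr; exact (A.le_opNorm _).trans (by gcongr; exact norm_bcfOfBounded_le hh hB)
        _ ≤ Λ * B := by rw [hΛ]; nlinarith [norm_nonneg (slabLin hab U), norm_nonneg A]
  · -- uniformly small tails on the unit ball
    intro ε hε
    have hmU := measurable_uncurry_slabPhys hab U
    obtain ⟨A₁, hA₁⟩ := exists_forall_norm_oseenDuhamel_le_of_norm_left_uniform (E := ℝ³) (s := a)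
      (T := b) (Mq := ‖A‖) hmU (norm_nonneg U) (norm_nonneg A) (slabPhys_bound hab U b)
      (slabPhys_decay_of_mem hab hUcz b) (half_pos hε)
    obtain ⟨A₂, hA₂⟩ := exists_forall_norm_oseenDuhamel_le_of_norm_right_uniform (E := ℝ³) (s := a)
      (T := b) (Mp := ‖A‖) hmU (norm_nonneg A) (norm_nonneg U) (slabPhys_bound hab U b)
      (slabPhys_decay_of_mem hab hUcz b) (half_pos hε)
    refine ⟨max A₁ A₂, fun h hh hh0 _ h1 x hx => ?_⟩
    set W := A (bcfOfBounded h) with hW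
    have hWn : ‖W‖ ≤ ‖A‖ := (A.le_opNorm _).trans (by
      have := norm_bcfOfBounded_le hh h1; nlinarith [norm_nonneg A])
    have hWb : ∀ τ ∈ Ioo a b, ∀ y, ‖slabPhys hab W τ y‖ ≤ ‖A‖ := fun τ _ y =>
      (norm_slabPhys_le hab W τ y).trans hWn
    have hmW := measurable_uncurry_slabPhys hab W
    rw [hKlin_eq h hh 1 h1 x, norm_neg, slabLin_apply, linOseen]
    calc ‖oseenDuhamel 1 a (slabPhys hab U) (slabPhys hab W) b' x +
          oseenDuhamel 1 a (slabPhys hab W) (slabPhys hab U) b' x‖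
        ≤ ‖oseenDuhamel 1 a (slabPhys hab U) (slabPhys hab W) b' x‖ +
          ‖oseenDuhamel 1 a (slabPhys hab W) (slabPhys hab U) b' x‖ := norm_add_le _ _
      _ ≤ ε / 2 + ε / 2 := add_le_add (hA₁ _ hmW hWb b' hb'mem x ((le_max_left _ _).trans hx))
          (hA₂ _ hmW hWb b' hb'mem x ((le_max_right _ _).trans hx))
      _ = ε := by ring
  · -- uniform modulus of continuity in space on the unit ball
    intro ε hε
    obtain ⟨η₁, hη₁, hmod₁⟩ := exists_forall_norm_oseenDuhamel_sub_le_space (E := ℝ³) (s := a)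
      (T := b) (Mp := ‖U‖) (Mq := ‖A‖) (norm_nonneg U) (norm_nonneg A) hab' hb'mem.2 (half_pos hε)
    obtain ⟨η₂, hη₂, hmod₂⟩ := exists_forall_norm_oseenDuhamel_sub_le_space (E := ℝ³) (s := a)
      (T := b) (Mp := ‖A‖) (Mq := ‖U‖) (norm_nonneg A) (norm_nonneg U) hab' hb'mem.2 (half_pos hε)
    refine ⟨min η₁ η₂, lt_min hη₁ hη₂, fun h hh hh0 _ h1 x y hxy => ?_⟩
    set W := A (bcfOfBounded h) with hW
    have hWn : ‖W‖ ≤ ‖A‖ := (A.le_opNorm _).trans (by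
      have := norm_bcfOfBounded_le hh h1; nlinarith [norm_nonneg A])
    have hWb : ∀ τ ∈ Ioo a b, ∀ y, ‖slabPhys hab W τ y‖ ≤ ‖A‖ := fun τ _ y =>
      (norm_slabPhys_le hab W τ y).trans hWn
    have hmW := aestronglyMeasurable_uncurry_slabPhys hab W
      ((volume : Measure (ℝ × ℝ³)).restrict (Ioo a b ×ˢ univ))
    have hmU := aestronglyMeasurable_uncurry_slabPhys hab U
      ((volume : Measure (ℝ × ℝ³)).restrict (Ioo a b ×ˢ univ))
    have hxy' : ‖x - y‖ < min η₁ η₂ := by rwa [← dist_eq_norm]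
    rw [hKlin_eq h hh 1 h1 x, hKlin_eq h hh 1 h1 y, slabLin_apply, slabLin_apply, linOseen, linOseen]
    have e1 := hmod₁ _ _ hmU hmW (slabPhys_bound hab U b) hWb x y (hxy'.trans_le (min_le_left _ _))
    have e2 := hmod₂ _ _ hmW hmU hWb (slabPhys_bound hab U b) x y (hxy'.trans_le (min_le_right _ _))
    calc ‖-(oseenDuhamel 1 a (slabPhys hab U) (slabPhys hab W) b' x +
            oseenDuhamel 1 a (slabPhys hab W) (slabPhys hab U) b' x) -
          -(oseenDuhamel 1 a (slabPhys hab U) (slabPhys hab W) b' y +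
            oseenDuhamel 1 a (slabPhys hab W) (slabPhys hab U) b' y)‖
        = ‖(oseenDuhamel 1 a (slabPhys hab U) (slabPhys hab W) b' y -
            oseenDuhamel 1 a (slabPhys hab U) (slabPhys hab W) b' x) +
            (oseenDuhamel 1 a (slabPhys hab W) (slabPhys hab U) b' y -
            oseenDuhamel 1 a (slabPhys hab W) (slabPhys hab U) b' x)‖ := by congr 1; abel
      _ ≤ ε / 2 + ε / 2 := (norm_add_le _ _).trans (add_le_add (by rw [norm_sub_rev]; exact e1)
          (by rw [norm_sub_rev]; exact e2))
      _ = ε := by ring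
  · -- strict differentiability at `0` of the final slice
    intro ε hε
    have hlo := (hasStrictFDerivAt_iff_isLittleO.1 hderiv)
    rw [Asymptotics.isLittleO_iff] at hlo
    have hev := hlo hε
    obtain ⟨δ', hδ', hball⟩ := Metric.eventually_nhds_iff.1 hev
    refine ⟨min δ' r, lt_min hδ' hr, fun g₁ g₂ hg₁ _ _ hg₂ _ _ B Bd hB₁ hB₂ hBδ hBd x => ?_⟩
    have hBd0 : 0 ≤ Bd := (norm_nonneg _).trans (hBd 0)
    have hn1 : ‖bcfOfBounded g₁‖ ≤ B := norm_bcfOfBounded_le hg₁ hB₁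
    have hn2 : ‖bcfOfBounded g₂‖ ≤ B := norm_bcfOfBounded_le hg₂ hB₂
    have hpair : dist (bcfOfBounded g₁, bcfOfBounded g₂) ((0 : ℝ³ →ᵇ ℝ³), (0 : ℝ³ →ᵇ ℝ³)) < δ' := by
      simp only [Prod.dist_eq, dist_zero_right]
      exact max_lt (hn1.trans_lt (hBδ.trans_le (min_le_left _ _)))
        (hn2.trans_lt (hBδ.trans_le (min_le_left _ _)))
    have key := hball hpair
    simp only at key
    have hd : ‖bcfOfBounded g₁ - bcfOfBounded g₂‖ ≤ Bd := by
      rw [← bcfOfBounded_sub hg₁ ⟨B, hB₁⟩ hg₂ ⟨B, hB₂⟩]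
      exact norm_bcfOfBounded_le (hg₁.sub hg₂) hBd
    -- the pointwise remainder is dominated by the sup norm of the remainder
    have hpt : ‖(sol (bcfOfBounded g₁) - sol (bcfOfBounded g₂) - A (bcfOfBounded g₁ - bcfOfBounded g₂)) (⟨b', hb'mem⟩, x)‖ ≤ ε * Bd :=
      (BoundedContinuousFunction.norm_coe_le_norm _ _).trans (key.trans (by gcongr))
    -- identify the pieces
    have hA12 : A (bcfOfBounded g₁ - bcfOfBounded g₂) (⟨b', hb'mem⟩, x) =
        heatFlow (g₁ - g₂) (1 - (c ^ 2)⁻¹) x + Klin (g₁ - g₂) x := by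
      simp only [Klin]
      rw [bcfOfBounded_sub hg₁ ⟨B, hB₁⟩ hg₂ ⟨B, hB₂⟩, hb'a]
      abel
    have hΦ₁ : Φ g₁ b' x = sol (bcfOfBounded g₁) (⟨b', hb'mem⟩, x) := slabPhys_of_mem hab _ hb'mem x
    have hΦ₂ : Φ g₂ b' x = sol (bcfOfBounded g₂) (⟨b', hb'mem⟩, x) := slabPhys_of_mem hab _ hb'mem x
    rw [hΦ₁, hΦ₂, ← hA12]
    simpa only [BoundedContinuousFunction.coe_sub, Pi.sub_apply] using hpt

end Summit.NavierStokesRegularity.NavierStokesRegularity.Theorems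


end
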